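import Summits.CriticalPhenomena.PercolationContinuityZ3.Theorems.PercNearOneGluingNoHeavyLowerTailKNGoodSinglePort
import HarnessLib

/-!
# GC when the loneliest relay is a port of a TWO-port pendant child — and goodness for two two-port stars covering the relays
# (`NoHeavyLowerTail` cell, stmt-CriticalPhenomena-4575; prover `prim-hp-2`, deletion–contraction line, gen 4)

Support file (`--supports stmt-CriticalPhenomena-4575`).  No definitions, no named facts, no sorries.
Port-free reduction (`KNGoodPortFree.agood_eq_factor_two_hairs` + loser-lowering `KNGoodLoser.argmin_of_lower_pairs`) followed by the
single-port theorem (`KNGoodSinglePort.gc_of_singlePort`): if the pendant child `x` has ports `{a₀, p}` where `a₀` minimises `P_{G−o}(· ↔ b)`,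
then after stripping the hairs at `a₀` the child `x` is single-port, so GC holds — for ANY core and any pendant star `y`.  Consequence: the lead's
minimal 'linked ports' configuration (β) (`x–{p₁,p₂}`, `y–{q₁,q₂}`, every relay a port, arbitrary core on the relays) is good.

* `KNGoodTwoPortArgmin.gc_of_twoPort_argminPort` — GC when `x`'s ports are `{a₀, p}`.
* `KNGoodTwoPortArgmin.knGood_twoTwoPortStars` — `o` + hairs + two pendant stars with ≤ 2 ports each whose ports (with `b`) exhaust `A`, any core
  ⇒ `(G, A, o, b)` good.
-/

noncomputable section

namespace Summit.CriticalPhenomena.PercolationContinuityZ3.Theorems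

open MeasureTheory Set Literature.Probability.LatticeModels Literature.Probability.Percolation
open scoped Classical BigOperators

variable {n : ℕ}

namespace KNGoodTwoPortArgmin

open ChampionStability KNGoodAux KNGoodHair RelayNbhd CILTwoSteiner KNGoodSeries KNGoodSeriesEasy KNGoodLoser KNGoodPortFree KNGoodHubStar
  KNGoodSinglePort KNGoodNotLonely

/-- **GC when the minimiser is a port of a two-port child.**  In `u = G − o`: `x ∉ A` with possibly-positive pairs only `s(x,a₀)`, `s(x,p)`
(`a₀, p ∈ A`), `y ∉ A` a pendant relay-star, `x ≠ y`, `b ∉ {x, y}`, `a₀` a minimiser of `P_u(· ↔ b)` over `A`, hair weights `u s(x,a₀), u s(y,a₀) < 1`.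
Then `agood(u[s(x,y) ↦ 1], x; a₀) ≥ 0`. [cite: KozmaNitzan2024, Thm. 4 (p. 12), Thm. 5 (p. 13), Lemma 5 (p. 13) — extension] -/
theorem gc_of_twoPort_argminPort (u : Sym2 (Fin n) → unitInterval) (A : Finset (Fin n)) (hA : A.Nonempty)
    (x y p a₀ b : Fin n) (hx : x ∉ A) (hy : y ∉ A) (hxy : x ≠ y) (hp : p ∈ A) (ha₀ : a₀ ∈ A) (hbx : b ≠ x) (hby : b ≠ y)
    (hxN : ∀ z : Fin n, z ≠ x → z ≠ p → z ≠ a₀ → u s(x, z) = 0)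
    (hyN : ∀ z : Fin n, z ≠ y → z ∉ A → u s(y, z) = 0)
    (hx1 : (u s(x, a₀) : ℝ) < 1) (hy1 : (u s(y, a₀) : ℝ) < 1)
    (hmin : ∀ a' ∈ A, (prodBernoulli u).real (openConn a₀ b) ≤ (prodBernoulli u).real (openConn a' b)) :
    0 ≤ (prodBernoulli (Function.update u s(x, y) 1)).real (openConn x b) -
        (prodBernoulli (Function.update u s(x, y) 1)).real (openConn a₀ b) +
        ∑ W ∈ nullSets A, (prodBernoulli (Function.update u s(x, y) 1)).real (clusterIs x W) *
          A.inf' hA (fun a' => (prodBernoulli (Function.update u s(x, y) 1)).real (openConnIn ((↑W : Set (Fin n))ᶜ) a' b)) := by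
  set us := Function.update u s(x, y) 1 with hus
  have hxa : x ≠ a₀ := fun h => hx (h ▸ ha₀)
  have hya : y ≠ a₀ := fun h => hy (h ▸ ha₀)
  have hglue : us s(x, y) = 1 := by rw [hus, Function.update_self]
  have hne_xy_xa : s(x, y) ≠ s(x, a₀) := fun h => hya (Sym2.congr_right.1 h)
  have hne_xy_ya : s(x, y) ≠ s(y, a₀) := by
    intro h; rcases Sym2.eq_iff.1 h with ⟨h1, -⟩ | ⟨h1, -⟩
    · exact hxy h1
    · exact hxa h1
  have hne_xa_ya : s(x, a₀) ≠ s(y, a₀) := fun h => hxy (Sym2.congr_left.1 h)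
  have husoff : ∀ e : Sym2 (Fin n), e ≠ s(x, y) → us e = u e := fun e he => by rw [hus, Function.update_of_ne he]
  rw [agood_eq_factor_two_hairs us A hA x y a₀ b hxa hya hxy ha₀ hglue]
  -- the stripped graphs
  set u' := Function.update (Function.update u s(x, a₀) 0) s(y, a₀) 0 with hu'
  have hcomm : Function.update (Function.update us s(x, a₀) 0) s(y, a₀) 0 = Function.update u' s(x, y) 1 := by
    rw [hu', hus, Function.update_comm hne_xy_xa, Function.update_comm hne_xy_ya]
  rw [hcomm]
  -- `a₀` is still the minimiser after lowering its two hairs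
  have hxZ : a₀ ∉ ({x, y} : Finset (Fin n)) := by
    simp only [Finset.mem_insert, Finset.mem_singleton, not_or]; exact ⟨fun h => hxa h.symm, fun h => hya h.symm⟩
  have hmin' : ∀ a' ∈ A, (prodBernoulli u').real (openConn a₀ b) ≤ (prodBernoulli u').real (openConn a' b) := by
    refine argmin_of_lower_pairs u u' A a₀ b {x, y} hxZ ?_ ?_ ?_ hmin
    · intro e he
      have hex : e ≠ s(y, a₀) := by rw [Sym2.eq_swap]; exact he y (by simp)
      have hey : e ≠ s(x, a₀) := by rw [Sym2.eq_swap]; exact he x (by simp)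
      rw [hu', Function.update_of_ne hex, Function.update_of_ne hey]
    · intro z hz
      simp only [Finset.mem_insert, Finset.mem_singleton] at hz
      rcases hz with rfl | rfl
      · rw [Sym2.eq_swap, hu', Function.update_of_ne hne_xa_ya, Function.update_self]; exact bot_le
      · rw [Sym2.eq_swap, hu', Function.update_self]; exact bot_le
    · intro z hz
      simp only [Finset.mem_insert, Finset.mem_singleton] at hz
      rcases hz with rfl | rfl
      · rw [Sym2.eq_swap]; exact hx1
      · rw [Sym2.eq_swap]; exact hy1
  -- in `u'`, `x` is single-port (`p`) and `y` is still a pendant star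
  have hxpend : ∀ z : Fin n, z ≠ x → z ≠ p → u' s(x, z) = 0 := by
    intro z hzx hzp
    by_cases hza : z = a₀
    · rw [hza, hu', Function.update_of_ne hne_xa_ya, Function.update_self]
    · have h1 : s(x, z) ≠ s(y, a₀) := by
        intro h; rcases Sym2.eq_iff.1 h with ⟨h2, -⟩ | ⟨h2, -⟩
        · exact hxy h2
        · exact hxa h2
      have h2 : s(x, z) ≠ s(x, a₀) := fun h => hza (Sym2.congr_right.1 h)
      rw [hu', Function.update_of_ne h1, Function.update_of_ne h2]; exact hxN z hzx hzp hza
  have hyN' : ∀ z : Fin n, z ≠ y → z ∉ A → u' s(y, z) = 0 := by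
    intro z hzy hzA
    have hza : z ≠ a₀ := fun h => hzA (h ▸ ha₀)
    have h1 : s(y, z) ≠ s(y, a₀) := fun h => hza (Sym2.congr_right.1 h)
    have h2 : s(y, z) ≠ s(x, a₀) := by
      intro h; rcases Sym2.eq_iff.1 h with ⟨h3, -⟩ | ⟨h3, -⟩
      · exact hxy h3.symm
      · exact hya h3
    rw [hu', Function.update_of_ne h1, Function.update_of_ne h2]; exact hyN z hzy hzA
  have hgc := gc_of_singlePort u' A hA x y p a₀ b hx hy hxy hp ha₀ hbx hby hxpend hyN' hmin'
  have h1 : 0 ≤ 1 - (us s(x, a₀) : ℝ) := by linarith [(us s(x, a₀)).2.2]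
  have h2 : 0 ≤ 1 - (us s(y, a₀) : ℝ) := by linarith [(us s(y, a₀)).2.2]
  exact mul_nonneg (mul_nonneg h1 h2) hgc

/-- **Goodness for `o` + relay hairs + two pendant stars with at most two ports each whose ports, together with `b`, exhaust the relay set —
on an ARBITRARY core** (the 'linked ports' configuration (β) of the cell's lead memo, with any relay–relay structure).  `x` has ports within
`{p₁, p₂}`, `y` within `{q₁, q₂}`, `A ⊆ {b, p₁, p₂, q₁, q₂}`, hair weights `< 1`.  Then `(G, A, o, b)` is good.
[cite: KozmaNitzan2024, Thm. 4 (p. 12), Thm. 5 (p. 13) — extension] -/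
theorem knGood_twoTwoPortStars (w : Sym2 (Fin n) → unitInterval) (A : Finset (Fin n)) (hA : A.Nonempty)
    (o x y b p₁ p₂ q₁ q₂ : Fin n) (ho : o ∉ A) (hx : x ∉ A) (hy : y ∉ A) (hxo : x ≠ o) (hyo : y ≠ o) (hxy : x ≠ y)
    (hbo : b ≠ o) (hbx : b ≠ x) (hby : b ≠ y)
    (hp₁ : p₁ ∈ A) (hp₂ : p₂ ∈ A) (hq₁ : q₁ ∈ A) (hq₂ : q₂ ∈ A)
    (hAports : ∀ a ∈ A, a = b ∨ a = p₁ ∨ a = p₂ ∨ a = q₁ ∨ a = q₂)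
    (hoN : ∀ v : Fin n, v ≠ o → v ∉ A → v ≠ x → v ≠ y → w s(o, v) = 0)
    (hxN : ∀ z : Fin n, z ≠ x → z ≠ p₁ → z ≠ p₂ → z ≠ o → w s(x, z) = 0)
    (hyN : ∀ z : Fin n, z ≠ y → z ≠ q₁ → z ≠ q₂ → z ≠ o → w s(y, z) = 0)
    (hx1 : ∀ a ∈ A, (w s(x, a) : ℝ) < 1) (hy1 : ∀ a ∈ A, (w s(y, a) : ℝ) < 1) :
    KNGood w A hA o b := by
  haveI : ∀ v : Sym2 (Fin n) → unitInterval, IsProbabilityMeasure (prodBernoulli v) := fun v => inferInstance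
  set w' : Sym2 (Fin n) → unitInterval := fun e => if ∃ q ∈ A, e = s(o, q) then 0 else w e with hw'
  refine knGood_of_deleteHairs w A hA o b ho ?_
  rw [← hw']
  have hpin : pinW w' {e : Sym2 (Fin n) | o ∈ e ∧ ¬ e.IsDiag} ∅ = pinW w {e : Sym2 (Fin n) | o ∈ e ∧ ¬ e.IsDiag} ∅ := by
    refine pinW_star_eq_of_eqOff w w' o fun e he => ?_
    rw [hw']; simp only
    rw [if_neg]
    rintro ⟨q, hq, rfl⟩
    exact he ⟨Sym2.mem_mk_left o q, fun hd => ho ((Sym2.mk_isDiag_iff.1 hd) ▸ hq)⟩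
  set u := pinW w {e : Sym2 (Fin n) | o ∈ e ∧ ¬ e.IsDiag} ∅ with hu
  have huoff : ∀ c d : Fin n, c ≠ o → d ≠ o → u s(c, d) = w s(c, d) := by
    intro c d hc hd
    have hmem : s(c, d) ∉ {e : Sym2 (Fin n) | o ∈ e ∧ ¬ e.IsDiag} := by
      rintro ⟨hoe, -⟩
      rcases Sym2.mem_iff.1 hoe with h | h
      · exact hc h.symm
      · exact hd h.symm
    rw [hu, pinW_apply_of_not_mem w ∅ hmem]
  have huo : ∀ v : Fin n, v ≠ o → u s(v, o) = 0 := by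
    intro v hv; rw [Sym2.eq_swap, hu]; exact pinW_star_mk w hv
  have hxNu : ∀ z : Fin n, z ≠ x → z ≠ p₁ → z ≠ p₂ → u s(x, z) = 0 := by
    intro z hzx h1 h2
    by_cases hzo : z = o
    · rw [hzo]; exact huo x hxo
    · rw [huoff x z hxo hzo]; exact hxN z hzx h1 h2 hzo
  have hyNu : ∀ z : Fin n, z ≠ y → z ≠ q₁ → z ≠ q₂ → u s(y, z) = 0 := by
    intro z hzy h1 h2
    by_cases hzo : z = o
    · rw [hzo]; exact huo y hyo
    · rw [huoff y z hyo hzo]; exact hyN z hzy h1 h2 hzo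
  have hxNA : ∀ z : Fin n, z ≠ x → z ∉ A → u s(x, z) = 0 :=
    fun z hzx hzA => hxNu z hzx (fun h => hzA (h ▸ hp₁)) (fun h => hzA (h ▸ hp₂))
  have hyNA : ∀ z : Fin n, z ≠ y → z ∉ A → u s(y, z) = 0 :=
    fun z hzy hzA => hyNu z hzy (fun h => hzA (h ▸ hq₁)) (fun h => hzA (h ▸ hq₂))
  have hgoodx : KNGood u A hA x b := KozmaNitzan2024_thm4_good u A hA x b hx hxNA
  have hgoody : KNGood u A hA y b := KozmaNitzan2024_thm4_good u A hA y b hy hyNA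
  obtain ⟨a₀, ha₀, hmin⟩ := A.exists_min_image (fun a => (prodBernoulli u).real (openConn a b)) hA
  have hxa : x ≠ a₀ := fun h => hx (h ▸ ha₀)
  have hya : y ≠ a₀ := fun h => hy (h ▸ ha₀)
  have hao : a₀ ≠ o := fun h => ho (h ▸ ha₀)
  have hx1u : (u s(x, a₀) : ℝ) < 1 := by rw [huoff x a₀ hxo hao]; exact hx1 a₀ ha₀
  have hy1u : (u s(y, a₀) : ℝ) < 1 := by rw [huoff y a₀ hyo hao]; exact hy1 a₀ ha₀
  -- GC: by cases on which port `a₀` is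
  have hGC : 0 ≤ (prodBernoulli (Function.update u s(x, y) 1)).real (openConn x b) -
      (prodBernoulli (Function.update u s(x, y) 1)).real (openConn a₀ b) +
      ∑ W ∈ nullSets A, (prodBernoulli (Function.update u s(x, y) 1)).real (clusterIs x W) *
        A.inf' hA (fun a' => (prodBernoulli (Function.update u s(x, y) 1)).real (openConnIn ((↑W : Set (Fin n))ᶜ) a' b)) := by
    -- single-port cases for `x` (ports ⊆ {a₀, p}) and for `y` (ports ⊆ {a₀, q}) via the observer swap
    have caseX : ∀ p : Fin n, p ∈ A → (∀ z : Fin n, z ≠ x → z ≠ p → z ≠ a₀ → u s(x, z) = 0) →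
        0 ≤ (prodBernoulli (Function.update u s(x, y) 1)).real (openConn x b) -
          (prodBernoulli (Function.update u s(x, y) 1)).real (openConn a₀ b) +
          ∑ W ∈ nullSets A, (prodBernoulli (Function.update u s(x, y) 1)).real (clusterIs x W) *
            A.inf' hA (fun a' => (prodBernoulli (Function.update u s(x, y) 1)).real (openConnIn ((↑W : Set (Fin n))ᶜ) a' b)) :=
      fun p hp hxp => gc_of_twoPort_argminPort u A hA x y p a₀ b hx hy hxy hp ha₀ hbx hby hxp hyNA hx1u hy1u hmin
    have caseY : ∀ q : Fin n, q ∈ A → (∀ z : Fin n, z ≠ y → z ≠ q → z ≠ a₀ → u s(y, z) = 0) →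
        0 ≤ (prodBernoulli (Function.update u s(x, y) 1)).real (openConn x b) -
          (prodBernoulli (Function.update u s(x, y) 1)).real (openConn a₀ b) +
          ∑ W ∈ nullSets A, (prodBernoulli (Function.update u s(x, y) 1)).real (clusterIs x W) *
            A.inf' hA (fun a' => (prodBernoulli (Function.update u s(x, y) 1)).real (openConnIn ((↑W : Set (Fin n))ᶜ) a' b)) := by
      intro q hq hyq
      have hglue : Function.update u s(x, y) 1 s(x, y) = 1 := Function.update_self _ _ _
      rw [agood_swap_glued (Function.update u s(x, y) 1) A hA x y a₀ b hxy hglue,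
        show Function.update u s(x, y) 1 = Function.update u s(y, x) 1 by rw [Sym2.eq_swap]]
      exact gc_of_twoPort_argminPort u A hA y x q a₀ b hy hx (Ne.symm hxy) hq ha₀ hby hbx hyq hxNA hy1u hx1u hmin
    rcases hAports a₀ ha₀ with h | h | h | h | h
    · -- `a₀ = b`: `x`'s ports are `{p₁, p₂}`; strip nothing special: use caseX with p := p₁ after noting hair to a₀=b ... `x` may have both ports;
      -- but `P_u(b ↔ b) = 1 ≤ P_u(a' ↔ b)` forces every relay to be surely connected; simplest: caseX needs `x`'s ports ⊆ {a₀, p}` — not available.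
      -- Instead: with `a₀ = b`, `P(a₀ ↔ b) = 1` and the glued observer's goodness LHS is ≥ inf' = 1... use the gain-free route: `hmin` gives all relays
      -- probability 1, so the claim is `KNGood` of the glued star with witness value ≤ inf'.
      subst a₀
      have hone : ∀ a' ∈ A, (prodBernoulli (Function.update u s(x, y) 1)).real (openConn a' b) = 1 := by
        intro a' ha'
        have hbb : (prodBernoulli u).real (openConn b b) = 1 := by
          have : (openConn b b : Set (BondConfig (Fin n))) = univ :=
            eq_univ_of_forall fun ω => (SimpleGraph.Reachable.refl b : (openGraph ω).Reachable b b)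
          rw [this, probReal_univ]
        have h1 : 1 ≤ (prodBernoulli u).real (openConn a' b) := hbb ▸ hmin a' ha'
        have h2 : (prodBernoulli u).real (openConn a' b) ≤ (prodBernoulli (Function.update u s(x, y) 1)).real (openConn a' b) := by
          have := real_openConn_mono a' b _ (Function.update u s(x, y) 1) u rfl (fun e => by
            by_cases he : e = s(x, y)
            · rw [he, Function.update_self]; exact le_top
            · rw [Function.update_of_ne he])
          exact this
        exact le_antisymm measureReal_le_one (h1.trans h2)
      -- goodness of the glued star at `x` (Thm 5 with twin `y` + Thm 4), then witness `b` has probability `1 = inf'`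
      have hgood2 : KNGood (Function.update u s(x, y) 1) A hA x b := by
        refine KozmaNitzan2024_thm5 (Function.update u s(x, y) 1) A hA x b y hx hbx (Ne.symm hxy) (fun z hzx hzA hzy => ?_) ?_
        · rw [Function.update_of_ne (fun h => hzy (Sym2.congr_right.1 h))]; exact hxNA z hzx hzA
        · refine KozmaNitzan2024_thm4_good (restrW ({x}ᶜ : Set (Fin n)) (Function.update u s(x, y) 1)) A hA y b hy fun z hzy hzA => ?_
          by_cases hzx : z = x
          · rw [hzx]
            refine restrW_apply_of_not_mem _ fun hmem => ?_
            exact (hmem.1 x (Sym2.mem_mk_right y x)) rfl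
          · have hne : s(y, z) ≠ s(x, y) := by
              intro h'; rcases Sym2.eq_iff.1 h' with ⟨h3, -⟩ | ⟨-, h3⟩
              · exact hxy h3.symm
              · exact hzx h3
            refine le_antisymm ((restrW_le _ _ s(y, z)).trans (le_of_eq ?_)) bot_le
            rw [Function.update_of_ne hne]; exact hyNA z hzy hzA
      have hg := hgood2
      rw [KNGood] at hg
      have hinf : A.inf' hA (fun a' => (prodBernoulli (Function.update u s(x, y) 1)).real (openConn a' b)) =
          (prodBernoulli (Function.update u s(x, y) 1)).real (openConn b b) := by
        rw [hone b ha₀]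
        exact le_antisymm ((Finset.inf'_le _ ha₀).trans (le_of_eq (hone b ha₀)))
          ((Finset.le_inf'_iff hA _).2 fun a' ha' => (hone a' ha').symm.le)
      linarith
    · -- `a₀ = p₁`: `x`'s ports ⊆ {a₀, p₂}
      subst a₀
      exact caseX p₂ hp₂ fun z hzx hz2 hz1 => hxNu z hzx hz1 hz2
    · subst a₀
      exact caseX p₁ hp₁ fun z hzx hz1 hz2 => hxNu z hzx hz1 hz2
    · subst a₀
      exact caseY q₂ hq₂ fun z hzy hz2 hz1 => hyNu z hzy hz1 hz2
    · subst a₀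
      exact caseY q₁ hq₁ fun z hzy hz1 hz2 => hyNu z hzy hz1 hz2
  exact knGood_series_of_gluing w' A hA o x y a₀ b ho hxo hyo hxy ha₀ hbo
    (fun v hvo hvx hvy => by
      rw [hw']; simp only
      by_cases hvA : v ∈ A
      · rw [if_pos ⟨v, hvA, rfl⟩]; rfl
      · rw [if_neg]
        · exact congrArg Subtype.val (hoN v hvo hvA hvx hvy)
        · rintro ⟨q, hq, hvq⟩
          exact hvA ((Sym2.congr_right.1 hvq) ▸ hq))
    (by rw [hpin]; exact hmin) (by rw [hpin]; exact hgoodx) (by rw [hpin]; exact hgoody) (by rw [hpin]; linarith [hGC])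

end KNGoodTwoPortArgmin

end Summit.CriticalPhenomena.PercolationContinuityZ3.Theorems

end
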